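import Mathlib.MeasureTheory.Integral.IntegralEqImproper
import Mathlib.MeasureTheory.Measure.Haar.InnerProductSpace
import Mathlib.MeasureTheory.Constructions.Pi
import Mathlib.Analysis.InnerProductSpace.PiL2
import Mathlib.Analysis.Calculus.ContDiff.Basic
import HarnessLib

/-!
# Integration by parts on `ℝᵈ`, `d ≥ 2`, for a function with a point singularity

Analysis/Calculus support file (everything proved, no definitions, no named facts).

**The lemma.** Let `d = n + 2 ≥ 2`, `a ∈ ℝᵈ`, `u : ℝᵈ → ℝ` differentiable on `ℝᵈ ∖ {a}` (no assumption at `a`),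
`φ ∈ C¹_c(ℝᵈ)`, and suppose the two products `u ∂_iφ` and `(∂_iu) φ` are integrable on `ℝᵈ` (e.g. `u`, `∇u` locally
integrable — the typical weakly singular kernels `|u| ≲ |x − a|^{1−d+ε}`, `|∇u| ≲ |x − a|^{−d+ε}`).  Then

  `∫ u ∂_iφ = −∫ (∂_iu) φ`.

No boundary term appears at the singularity.  *Proof (Fubini along coordinate lines).*  Split
`ℝᵈ = ℝ × ℝ^{d−1}` along the `i`-th coordinate (a volume-preserving measurable equivalence); for every `x' ∈ ℝ^{d−1}`
other than the projection of `a` — hence for a.e. `x'`, as `d − 1 ≥ 1` — the line `t ↦ (t, x')` avoids `a`, so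
`t ↦ u φ` is `C¹` with compact support there and `∫ d/dt (uφ) dt = 0`; integrate over `x'`.  (In dimension `1` the
statement is false: `u = sign`.)

* `integral_mul_fderiv_eq_neg_fderiv_mul_of_point_singularity` — the lemma, for the coordinate directions
  `EuclideanSpace.single i 1` of `EuclideanSpace ℝ (Fin (n + 2))`.

## Mathlib search

`integral_mul_fderiv_eq_neg_fderiv_mul_of_integrable` (IBP on `ℝᵈ` for GLOBALLY differentiable functions),
`integral_eq_zero_of_hasDerivAt_of_integrable` (dimension one), `volume_preserving_piFinSuccAbove`,
`EuclideanSpace.volume_preserving_symm_measurableEquiv_toLp`, `integral_prod_symm` — used; no version allowing a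
singular point (`lean search 'point singularity|punctured.*parts'`).

## References

* D. Gilbarg, N. S. Trudinger, *Elliptic PDE of Second Order*, §2.4–2.5 (Green's identities with an excised ball);
  the coordinate-line proof is folklore. [folklore]
-/

noncomputable section

open MeasureTheory Set Filter Function Metric
open scoped Topology

namespace Literature.Analysis.Calculus

variable {n : ℕ}

/-- The coordinate splitting `ℝᵈ ≃ ℝ × ℝ^{d−1}` along the `i`-th axis (as a measurable equivalence):
`x ↦ (xᵢ, (x_{i.succAbove j})_j)`. [folklore] -/
def axisSplit (i : Fin (n + 2)) : EuclideanSpace ℝ (Fin (n + 2)) ≃ᵐ ℝ × (Fin (n + 1) → ℝ) :=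
  (MeasurableEquiv.toLp 2 (Fin (n + 2) → ℝ)).symm.trans (MeasurableEquiv.piFinSuccAbove (fun _ ↦ ℝ) i)

/-- The splitting is volume preserving. [folklore] -/
theorem measurePreserving_axisSplit (i : Fin (n + 2)) :
    MeasurePreserving (axisSplit i) (volume : Measure (EuclideanSpace ℝ (Fin (n + 2)))) (volume : Measure (ℝ × (Fin (n + 1) → ℝ))) :=
  (EuclideanSpace.volume_preserving_symm_measurableEquiv_toLp (Fin (n + 2))).trans
    (volume_preserving_piFinSuccAbove (fun _ ↦ ℝ) i)

/-- The inverse splitting inserts the first coordinate at position `i`. [folklore] -/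
theorem axisSplit_symm_apply (i : Fin (n + 2)) (t : ℝ) (x' : Fin (n + 1) → ℝ) :
    (axisSplit i).symm (t, x') = WithLp.toLp 2 (Fin.insertNth i t x') := rfl

/-- Along the fibre, the inverse splitting is the affine line in the direction `eᵢ`:
`(axisSplit i)⁻¹ (t, x') = (axisSplit i)⁻¹ (0, x') + t eᵢ`. [folklore] -/
theorem axisSplit_symm_eq_add_smul (i : Fin (n + 2)) (t : ℝ) (x' : Fin (n + 1) → ℝ) :
    (axisSplit i).symm (t, x') = (axisSplit i).symm (0, x') + t • EuclideanSpace.single i (1 : ℝ) := by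
  rw [axisSplit_symm_apply, axisSplit_symm_apply]
  ext j
  simp only [PiLp.add_apply, PiLp.smul_apply, PiLp.single_apply, smul_eq_mul, mul_ite, mul_one,
    mul_zero]
  rcases Fin.eq_self_or_eq_succAbove i j with rfl | ⟨k, rfl⟩
  · simp [Fin.insertNth_apply_same]
  · simp [Fin.insertNth_apply_succAbove, Fin.succAbove_ne]

/-- The fibre through `(t, x')` meets `a` only if `x'` is the projection of `a`. [folklore] -/
theorem axisSplit_symm_ne (i : Fin (n + 2)) {a : EuclideanSpace ℝ (Fin (n + 2))} {x' : Fin (n + 1) → ℝ} (hx' : x' ≠ (axisSplit i a).2)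
    (t : ℝ) : (axisSplit i).symm (t, x') ≠ a := by
  intro h
  apply hx'
  have := congrArg (fun z ↦ (axisSplit i z).2) h
  simpa using this

/-- **Integration by parts with a point singularity** (`d ≥ 2`): for `u` differentiable off `a`, `φ ∈ C¹_c`,
and `u ∂_iφ`, `(∂_iu) φ` integrable, `∫ u ∂_iφ = −∫ (∂_iu) φ`. [folklore] -/
theorem integral_mul_fderiv_eq_neg_fderiv_mul_of_point_singularity (i : Fin (n + 2)) {a : EuclideanSpace ℝ (Fin (n + 2))} {u φ : EuclideanSpace ℝ (Fin (n + 2)) → ℝ}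
    (hu : ∀ x, x ≠ a → DifferentiableAt ℝ u x) (hφ : ContDiff ℝ 1 φ) (hφc : HasCompactSupport φ)
    (h₁ : Integrable fun x ↦ u x * fderiv ℝ φ x (EuclideanSpace.single i 1))
    (h₂ : Integrable fun x ↦ fderiv ℝ u x (EuclideanSpace.single i 1) * φ x) :
    ∫ x, u x * fderiv ℝ φ x (EuclideanSpace.single i 1) =
      -∫ x, fderiv ℝ u x (EuclideanSpace.single i 1) * φ x := by
  set v : EuclideanSpace ℝ (Fin (n + 2)) := EuclideanSpace.single i 1 with hv
  set G : EuclideanSpace ℝ (Fin (n + 2)) → ℝ := fun x ↦ fderiv ℝ u x v * φ x + u x * fderiv ℝ φ x v with hG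
  have hGi : Integrable G := h₂.add h₁
  -- it suffices to show `∫ G = 0`
  suffices hG0 : ∫ x, G x = 0 by
    rw [hG, integral_add h₂ h₁] at hG0
    linarith
  -- transport to `ℝ × ℝ^{d-1}`
  set Θ := axisSplit (n := n) i with hΘ
  have hΘ' : MeasurePreserving Θ.symm (volume : Measure (ℝ × (Fin (n + 1) → ℝ))) (volume : Measure (EuclideanSpace ℝ (Fin (n + 2)))) :=
    (measurePreserving_axisSplit i).symm
  have hcomp : ∫ x, G x = ∫ p : ℝ × (Fin (n + 1) → ℝ), G (Θ.symm p) :=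
    (hΘ'.integral_comp Θ.symm.measurableEmbedding G).symm
  rw [hcomp]
  have hGi' : Integrable (fun p : ℝ × (Fin (n + 1) → ℝ) ↦ G (Θ.symm p))
      ((volume : Measure ℝ).prod (volume : Measure (Fin (n + 1) → ℝ))) :=
    (hΘ'.integrable_comp_emb Θ.symm.measurableEmbedding).2 hGi
  rw [show (volume : Measure (ℝ × (Fin (n + 1) → ℝ))) = (volume : Measure ℝ).prod volume from rfl,
    integral_prod_symm _ hGi']
  -- the inner integrals vanish for a.e. `x'`
  have hae : ∀ᵐ x' : (Fin (n + 1) → ℝ), x' ≠ (Θ a).2 := by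
    have : ({(Θ a).2}ᶜ : Set (Fin (n + 1) → ℝ)) ∈ ae (volume : Measure (Fin (n + 1) → ℝ)) :=
      compl_mem_ae_iff.2 (measure_singleton _)
    filter_upwards [this] with x' hx'
    exact hx'
  refine integral_eq_zero_of_ae ?_
  filter_upwards [hae, hGi'.prod_left_ae] with x' hx' hint
  -- on the line `t ↦ L t := Θ⁻¹ (t, x')`, which avoids `a`
  set L : ℝ → EuclideanSpace ℝ (Fin (n + 2)) := fun t ↦ Θ.symm (t, x') with hL
  have hLne : ∀ t, L t ≠ a := fun t ↦ axisSplit_symm_ne i hx' t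
  have hLd : ∀ t, HasDerivAt L v t := by
    intro t
    have h : L = fun t ↦ Θ.symm (0, x') + t • v := funext fun t ↦ axisSplit_symm_eq_add_smul i t x'
    rw [h]
    simpa using ((hasDerivAt_id t).smul_const v).const_add (Θ.symm (0, x'))
  set g : ℝ → ℝ := fun t ↦ u (L t) * φ (L t) with hg
  have hg' : ∀ t, HasDerivAt g (G (L t)) t := by
    intro t
    have h1 : HasDerivAt (fun t ↦ u (L t)) (fderiv ℝ u (L t) v) t :=
      ((hu (L t) (hLne t)).hasFDerivAt.comp_hasDerivAt t (hLd t))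
    have h2 : HasDerivAt (fun t ↦ φ (L t)) (fderiv ℝ φ (L t) v) t :=
      ((hφ.differentiable one_ne_zero (L t)).hasFDerivAt.comp_hasDerivAt t (hLd t))
    have h3 := h1.mul h2
    simp only [hG, hg]
    exact h3
  -- `g` is continuous with compact support, hence integrable
  have hLc : Continuous L := by
    have h : L = fun t ↦ Θ.symm (0, x') + t • v := funext fun t ↦ axisSplit_symm_eq_add_smul i t x'
    rw [h]; exact continuous_const.add (continuous_id.smul continuous_const)
  have hgc : Continuous g :=
    (continuous_iff_continuousAt.2 fun t ↦ (hu (L t) (hLne t)).continuousAt.comp (hLc.continuousAt)).mul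
      (hφ.continuous.comp hLc)
  have hgs : HasCompactSupport g := by
    -- `φ ∘ L` has compact support: `L` is a proper affine map (`|L t| ≥ |t| - |L 0|`)
    obtain ⟨Rφ, hRφ⟩ := hφc.isCompact.isBounded.subset_closedBall 0
    refine HasCompactSupport.intro (isCompact_Icc (a := -(Rφ + ‖Θ.symm (0, x')‖)) (b := Rφ + ‖Θ.symm (0, x')‖))
      fun t ht ↦ ?_
    have hφ0 : φ (L t) = 0 := by
      by_contra h
      have hmem := hRφ (subset_tsupport _ (mem_support.2 h))
      rw [mem_closedBall, dist_zero_right] at hmem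
      have hnorm : ‖L t‖ ≥ |t| - ‖Θ.symm (0, x')‖ := by
        have h1 : L t = Θ.symm (0, x') + t • v := axisSplit_symm_eq_add_smul i t x'
        have hv1 : ‖v‖ = 1 := by simp [hv, PiLp.norm_single]
        have : ‖t • v‖ = |t| := by rw [norm_smul, hv1, mul_one, Real.norm_eq_abs]
        have h2 : ‖t • v‖ ≤ ‖L t‖ + ‖Θ.symm (0, x')‖ := by
          calc ‖t • v‖ = ‖L t - Θ.symm (0, x')‖ := by rw [h1, add_sub_cancel_left]
            _ ≤ ‖L t‖ + ‖Θ.symm (0, x')‖ := norm_sub_le _ _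
        linarith
      have ht' : Rφ + ‖Θ.symm (0, x')‖ < |t| := by
        by_contra hle
        exact ht (abs_le.1 (not_lt.1 hle))
      linarith
    simp [hg, hφ0]
  exact integral_eq_zero_of_hasDerivAt_of_integrable hg' hint (hgc.integrable_of_hasCompactSupport hgs)

end Literature.Analysis.Calculus

end
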